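import Literature.AlgebraicGeometry.Resolution.FormalCoordinateChange
import HarnessLib

/-!
# The formal inverse function theorem for `k[[x_σ]]`, `σ` any finite index type

Index-general companion of the two `Fin n` files of this directory:

* `FormalCoordinateChange.lean` — injectivity of a formal coordinate change with invertible linear
  part (`TangentId`, `MonPlus`, `linMat`, `normalize`; «Deliberately NOT here: surjectivity»);
* `FormalInverseFunction.lean` — the compositional inverse for `θ : Fin n → k[[x_1,…,x_n]]`
  (Newton iteration `invT` on the SOURCE side, `exists_comp_inverse`), packaged as a `k`-algebra
  automorphism in `Literature.RingTheory.MvPowerSeries.AdicLimit.exists_algEquiv_of_sub_X_mem_sq`.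

Both are stated for the index type `Fin n` only.  Frames of the form `k[[y, ω_1, …, ω_m]]` are
typed in the tree over `Option (Fin m)` (`y = X none`, `ω_i = X (some i)`; e.g. the §7.5 set-up
`GCleaningSetup.completionEquiv` of `Hironaka2017/S07Permissible/R044aGCleaningSetup.lean`), and
the re-coordinatisation `y ↦ y − u`, `ω` fixed, of such a frame needs the theorem over THAT index
type.  This file proves it directly for every `[Fintype σ] [DecidableEq σ]`, with the standing
hypothesis «`ψ` tangent to the identity» written with the existing predicate
`MonPlus (ψ i) (Finsupp.single i 1)` (`ψ i = X i + (order ≥ 2)`; for `σ = Fin n` this is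
`TangentId ψ`, `tangentId_iff_monPlus`), and by a different route (successive approximation on
the TARGET side):

* `coeff_subst_of_degree_le_order` — a tangent-to-identity substitution changes no coefficient of
  degree `≤ order F`; hence it PRESERVES THE ORDER of every series (`order_subst_eq_of_monPlus`)
  and the error `subst ψ F − F` has order `> order F` (`succ_le_order_subst_sub_self`);
* `subst_surjective_of_monPlus` — `g₀ = f`, `g_{m+1} = f − (subst ψ g_m − g_m)` has increments of
  order `≥ m + 1`; the coefficientwise limit `G` satisfies `subst ψ G = f`;
  with `subst_injective_of_monPlus`: `subst_bijective_of_monPlus`, `substAlgHom_bijective_of_monPlus`,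
  and the automorphism `exists_algEquiv_eq_subst` (`AlgEquiv.ofBijective`, stated as an existence —
  the file is definition-free);
* `exists_inverse_subst_of_monPlus` — the inverse is again a tangent-to-identity SUBSTITUTION;
* `exists_algEquiv_X_add` — the one-variable re-centring: for `2 ≤ order V` a `k`-algebra
  automorphism `e` of `k[[x_σ]]` with `e (X i) = X i + V`, `e (X j) = X j` (`j ≠ i`),
  `e = subst (Function.update X i (X i + V))`, `e.symm (X i + V) = X i`.

Sources: G.-M. Greuel, G. Pfister, *A Singular Introduction to Commutative Algebra* (2002),
Thm. 6.2.18 (Inverse Function Theorem: `φ(x_i) = f_i`, `f_i(0) = 0`, is an isomorphism of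
`K[[x_1,…,x_n]]` iff `det(∂f_i/∂x_j(0)) ≠ 0`; proof reduces to `(∂f_i/∂x_j(0)) = (δ_ij)`)
[cite: GreuelPfister2002, Thm. 6.2.18]; Y. Boubakri, G.-M. Greuel, T. Markwig, Lemma 2.2 and its
proof (`φ(x_i) = x_i + b_i`, `b_i ∈ 𝔪^{M+1}`, defines a coordinate change)
[cite: BoubakriGreuelMarkwig2010, Lemma 2.2].  Only the «if» direction (bijectivity) is proved
here, for the normalised (tangent-to-identity) case over any finite index type; no statement of
any manuscript under adjudication is involved.
-/
open MvPowerSeries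

namespace Literature.AlgebraicGeometry.Resolution.FormalCoordChange

variable {σ : Type*} {k : Type*} [Field k]

/-! ### `X^{e_i} +` higher order: coefficients in degree `≤ 1` -/

/-- An `X_i + h.o.t.` series has zero constant term (`f_i(0) = 0`). [cite: GreuelPfister2002, Thm. 6.2.18 (proof: normalisation (∂f_i/∂x_j(0)) = (δ_ij))] -/
theorem constantCoeff_eq_zero_of_monPlus_single [DecidableEq σ] {P : MvPowerSeries σ k} {i : σ}
    (hP : MonPlus P (Finsupp.single i 1)) : MvPowerSeries.constantCoeff P = 0 := by
  rw [← MvPowerSeries.coeff_zero_eq_constantCoeff_apply, coeff_of_monPlus hP 0 (by simp),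
    if_neg (Ne.symm (Finsupp.single_ne_zero.mpr one_ne_zero))]

/-- An `X_i + h.o.t.` series has linear part `X_i` (`∂f_i/∂x_j(0) = δ_ij`). [cite: GreuelPfister2002, Thm. 6.2.18 (proof: normalisation (∂f_i/∂x_j(0)) = (δ_ij))] -/
theorem coeff_single_of_monPlus_single [DecidableEq σ] {P : MvPowerSeries σ k} {i : σ}
    (hP : MonPlus P (Finsupp.single i 1)) (j : σ) :
    MvPowerSeries.coeff (Finsupp.single j 1) P = if i = j then 1 else 0 := by
  rw [coeff_of_monPlus hP _ (by simp [Finsupp.degree_single])]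
  by_cases hij : i = j
  · subst hij; simp
  · rw [if_neg hij, if_neg]
    exact fun h => hij ((Finsupp.single_left_inj one_ne_zero).mp h).symm

/-- Conversely: zero constant term and linear part `X_i` give an `X_i + h.o.t.` series.
[cite: GreuelPfister2002, Thm. 6.2.18 (proof: normalisation (∂f_i/∂x_j(0)) = (δ_ij))] -/
theorem monPlus_single_of_coeff [DecidableEq σ] {P : MvPowerSeries σ k} {i : σ}
    (h0 : MvPowerSeries.constantCoeff P = 0)
    (h1 : ∀ j, MvPowerSeries.coeff (Finsupp.single j 1) P = if i = j then 1 else 0) :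
    MonPlus P (Finsupp.single i 1) := by
  refine ⟨P - MvPowerSeries.X i, by simp [MvPowerSeries.X_def], ?_⟩
  rw [Finsupp.degree_single, Nat.cast_one]
  have : (2 : ℕ∞) ≤ (P - MvPowerSeries.X i).order := by
    rw [two_le_order_iff]
    refine ⟨by simp [h0, MvPowerSeries.constantCoeff_X], fun j => ?_⟩
    rw [map_sub, h1 j, MvPowerSeries.coeff_X]
    by_cases hij : i = j
    · subst hij; simp
    · have : ¬ (Finsupp.single j 1 : σ →₀ ℕ) = Finsupp.single i 1 := fun hh =>
        hij ((Finsupp.single_left_inj one_ne_zero).mp hh).symm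
      simp [this, hij]
  exact lt_of_lt_of_le (by norm_num) this

/-- `X_i` itself is `X_i + 0`. [cite: BoubakriGreuelMarkwig2010, Lemma 2.2 (proof: φ(x_i) = x_i + b_i)] -/
theorem monPlus_X (i : σ) : MonPlus (MvPowerSeries.X i : MvPowerSeries σ k) (Finsupp.single i 1) :=
  ⟨0, by simp [MvPowerSeries.X_def], by simp⟩

/-- `X_i + V` with `2 ≤ order V` is `X_i + h.o.t.`. [cite: BoubakriGreuelMarkwig2010, Lemma 2.2 (proof: φ(x_i) = x_i + b_i)] -/
theorem monPlus_X_add (i : σ) {V : MvPowerSeries σ k} (hV : 2 ≤ V.order) :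
    MonPlus (MvPowerSeries.X i + V) (Finsupp.single i 1) := by
  refine ⟨V, by simp [MvPowerSeries.X_def], ?_⟩
  rw [Finsupp.degree_single, Nat.cast_one]
  exact lt_of_lt_of_le (by norm_num) hV

/-- The one-variable re-centring family `X_i ↦ X_i + V`, `X_j ↦ X_j` (`j ≠ i`), `2 ≤ order V`, is
tangent to the identity. [cite: BoubakriGreuelMarkwig2010, Lemma 2.2 (proof: φ(x_i) = x_i + b_i)] -/
theorem monPlus_update_X_add [DecidableEq σ] (i : σ) {V : MvPowerSeries σ k} (hV : 2 ≤ V.order)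
    (j : σ) :
    MonPlus (Function.update (MvPowerSeries.X : σ → MvPowerSeries σ k) i (MvPowerSeries.X i + V) j)
      (Finsupp.single j 1) := by
  by_cases hji : j = i
  · subst hji
    rw [Function.update_self]
    exact monPlus_X_add j hV
  · rw [Function.update_of_ne hji]
    exact monPlus_X j

/-! ### Tangent-to-identity substitutions: order and lowest coefficients -/

section TangentToIdentity

variable [Fintype σ] [DecidableEq σ] {ψ : σ → MvPowerSeries σ k}

/-- A tangent-to-identity family is substitutable (`f_i(0) = 0`). [cite: GreuelPfister2002, Thm. 6.2.18 (Inverse Function Theorem)] -/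
theorem hasSubst_of_monPlus (hψ : ∀ i, MonPlus (ψ i) (Finsupp.single i 1)) :
    MvPowerSeries.HasSubst ψ :=
  MvPowerSeries.hasSubst_of_constantCoeff_zero fun i => constantCoeff_eq_zero_of_monPlus_single (hψ i)

/-- `subst ψ 0 = 0`. [folklore] -/
private theorem subst_zero_of_monPlus (hψ : ∀ i, MonPlus (ψ i) (Finsupp.single i 1)) :
    MvPowerSeries.subst ψ (0 : MvPowerSeries σ k) = 0 := by
  rw [← MvPowerSeries.coe_substAlgHom (hasSubst_of_monPlus hψ), map_zero]

/-- A tangent-to-identity substitution does not change the coefficients of degree `≤ order F`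
(`σ`-general form of `TangentId.coeff_subst_of_degree_le`; the mechanism «`φ(x_i) = x_i + b_i`, `b_i ∈ 𝔪²`
⟹ `φ(F) ≡ F` in low degrees» of the cited proof). [cite: BoubakriGreuelMarkwig2010, Lemma 2.2 (proof: φ(x_i) = x_i + b_i)] -/
theorem coeff_subst_of_degree_le_order (hψ : ∀ i, MonPlus (ψ i) (Finsupp.single i 1))
    (F : MvPowerSeries σ k) (e : σ →₀ ℕ) (he : (e.degree : ℕ∞) ≤ F.order) :
    MvPowerSeries.coeff e (MvPowerSeries.subst ψ F) = MvPowerSeries.coeff e F := by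
  classical
  rw [MvPowerSeries.coeff_subst (hasSubst_of_monPlus hψ)]
  have key : ∀ d : σ →₀ ℕ, e.degree ≤ d.degree →
      MvPowerSeries.coeff e (d.prod fun s m => ψ s ^ m) = if e = d then 1 else 0 := by
    intro d hd
    have hmp := monPlus_finsuppProd ψ (fun i => Finsupp.single i 1) hψ d
    have hsum : (d.sum fun s m => m • Finsupp.single s 1) = d := by
      conv_rhs => rw [← Finsupp.sum_single d]
      apply Finsupp.sum_congr
      intro i _
      simp [Finsupp.smul_single]
    rw [hsum] at hmp
    exact coeff_of_monPlus hmp e hd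
  rw [finsum_eq_single _ e]
  · rw [key e le_rfl, if_pos rfl, smul_eq_mul, mul_one]
  · intro d hde
    by_cases hlt : d.degree < e.degree
    · rw [MvPowerSeries.coeff_of_lt_order (lt_of_lt_of_le (by exact_mod_cast hlt) he), zero_smul]
    · push Not at hlt
      rw [key d hlt, if_neg (Ne.symm hde), smul_zero]

/-- **A tangent-to-identity substitution preserves the order of every series.**
[cite: BoubakriGreuelMarkwig2010, Lemma 2.2 (proof: φ(x_i) = x_i + b_i)] -/
theorem order_subst_eq_of_monPlus (hψ : ∀ i, MonPlus (ψ i) (Finsupp.single i 1))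
    (F : MvPowerSeries σ k) : (MvPowerSeries.subst ψ F).order = F.order := by
  apply le_antisymm
  · by_cases hF : F = 0
    · subst hF; simp
    · obtain ⟨e, he, hdeg⟩ := MvPowerSeries.exists_coeff_ne_zero_and_order
        (MvPowerSeries.ne_zero_iff_order_finite.mp hF)
      rw [← hdeg]
      apply MvPowerSeries.order_le
      rwa [coeff_subst_of_degree_le_order hψ F e hdeg.le]
  · have h1 : (1 : ℕ∞) ≤ ⨅ i, (ψ i).order :=
      le_iInf fun i => MvPowerSeries.one_le_order_iff_constCoeff_eq_zero.mpr
        (constantCoeff_eq_zero_of_monPlus_single (hψ i))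
    calc F.order = 1 * F.order := (one_mul _).symm
      _ ≤ (⨅ i, (ψ i).order) * F.order := mul_le_mul' h1 le_rfl
      _ ≤ _ := MvPowerSeries.le_order_subst (hasSubst_of_monPlus hψ) F

/-- The error term gains order: if `N ≤ order F` then `N + 1 ≤ order (subst ψ F − F)`
(`φ(F) − F ∈ 𝔪^(N+1)`). [cite: BoubakriGreuelMarkwig2010, Lemma 2.2 (proof: φ(x_i) = x_i + b_i)] -/
theorem succ_le_order_subst_sub_self (hψ : ∀ i, MonPlus (ψ i) (Finsupp.single i 1))
    {F : MvPowerSeries σ k} {N : ℕ} (hN : (N : ℕ∞) ≤ F.order) :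
    ((N + 1 : ℕ) : ℕ∞) ≤ (MvPowerSeries.subst ψ F - F).order := by
  apply MvPowerSeries.nat_le_order
  intro d hd
  have hd' : (d.degree : ℕ∞) ≤ F.order :=
    le_trans (by exact_mod_cast Nat.lt_succ_iff.mp hd) hN
  rw [map_sub, coeff_subst_of_degree_le_order hψ F d hd', sub_self]

/-! ### Injectivity, surjectivity, bijectivity -/

/-- A tangent-to-identity substitution is injective (`σ`-general form of
`TangentId.subst_ne_zero`; «only if»-free half of the cited theorem). [cite: GreuelPfister2002, Thm. 6.2.18 (Inverse Function Theorem)] -/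
theorem subst_injective_of_monPlus (hψ : ∀ i, MonPlus (ψ i) (Finsupp.single i 1)) :
    Function.Injective (MvPowerSeries.subst ψ : MvPowerSeries σ k → MvPowerSeries σ k) := by
  intro F F' h
  have h0 : MvPowerSeries.subst ψ (F - F') = 0 := by
    rw [MvPowerSeries.subst_sub (hasSubst_of_monPlus hψ), h, sub_self]
  have : F - F' = 0 := by
    rw [← MvPowerSeries.order_eq_top_iff, ← order_subst_eq_of_monPlus hψ, h0,
      MvPowerSeries.order_zero]
  exact sub_eq_zero.mp this

/-- **The formal inverse function theorem (surjectivity half): a tangent-to-identity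
substitution of `k[[x_σ]]` is surjective.**  Successive approximation: `g₀ = f`,
`g_{m+1} = f − (subst ψ g_m − g_m)`; the increments `g_{m+1} − g_m` have order `≥ m + 1`, so the
coefficients stabilise; the coefficientwise limit `G` has `subst ψ G = f`.  (The cited proof goes through
the formal implicit function theorem instead; the statement is its «if» direction in the normalised case
`(∂f_i/∂x_j(0)) = (δ_ij)`.) [cite: GreuelPfister2002, Thm. 6.2.18 (Inverse Function Theorem)] -/
theorem subst_surjective_of_monPlus (hψ : ∀ i, MonPlus (ψ i) (Finsupp.single i 1)) :
    Function.Surjective (MvPowerSeries.subst ψ : MvPowerSeries σ k → MvPowerSeries σ k) := by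
  intro f
  have hS := hasSubst_of_monPlus hψ
  -- the successive approximations
  obtain ⟨g, g_zero, g_succ⟩ : ∃ g : ℕ → MvPowerSeries σ k, g 0 = f ∧
      ∀ m, g (m + 1) = f - (MvPowerSeries.subst ψ (g m) - g m) :=
    ⟨fun m => Nat.rec f (fun _ gm => f - (MvPowerSeries.subst ψ gm - gm)) m, rfl, fun _ => rfl⟩
  -- increments gain one order per step
  have incr : ∀ m : ℕ, ((m + 1 : ℕ) : ℕ∞) ≤ (g (m + 1) - g m).order := by
    intro m
    induction m with
    | zero =>
      rw [g_succ, g_zero, sub_sub_cancel_left, MvPowerSeries.order_neg]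
      exact succ_le_order_subst_sub_self hψ (N := 0) (by simp)
    | succ m ih =>
      have : g (m + 1 + 1) - g (m + 1) =
          -(MvPowerSeries.subst ψ (g (m + 1) - g m) - (g (m + 1) - g m)) := by
        rw [g_succ (m + 1), g_succ m]
        simp only [MvPowerSeries.subst_sub hS]
        ring
      rw [this, MvPowerSeries.order_neg]
      exact succ_le_order_subst_sub_self hψ ih
  -- coefficients of degree `≤ m` are stationary from step `m` on
  have stab : ∀ (d : σ →₀ ℕ) (m M : ℕ), d.degree ≤ m → m ≤ M →
      MvPowerSeries.coeff d (g M) = MvPowerSeries.coeff d (g m) := by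
    intro d m M hdm hmM
    induction M, hmM using Nat.le_induction with
    | base => rfl
    | succ M hmM ih =>
      have h0 : MvPowerSeries.coeff d (g (M + 1) - g M) = 0 :=
        MvPowerSeries.coeff_of_lt_order
          (lt_of_lt_of_le (by exact_mod_cast Nat.lt_succ_of_le (hdm.trans hmM)) (incr M))
      rw [map_sub, sub_eq_zero] at h0
      rw [h0, ih]
  -- the coefficientwise limit
  obtain ⟨G, hGdef⟩ : ∃ G : MvPowerSeries σ k,
      ∀ d, MvPowerSeries.coeff d G = MvPowerSeries.coeff d (g d.degree) :=
    ⟨fun d => MvPowerSeries.coeff d (g d.degree), fun _ => rfl⟩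
  have hG : ∀ (d : σ →₀ ℕ) (m : ℕ), d.degree ≤ m →
      MvPowerSeries.coeff d G = MvPowerSeries.coeff d (g m) := fun d m hdm => by
    rw [hGdef, stab d d.degree m le_rfl hdm]
  have hGm : ∀ m : ℕ, ((m + 1 : ℕ) : ℕ∞) ≤ (G - g m).order := fun m =>
    MvPowerSeries.nat_le_order fun d hd => by
      rw [map_sub, hG d m (Nat.lt_succ_iff.mp hd), sub_self]
  refine ⟨G, ?_⟩
  ext d
  set m := d.degree with hm
  have h1 : MvPowerSeries.subst ψ G = MvPowerSeries.subst ψ (g (m + 1)) +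
      MvPowerSeries.subst ψ (G - g (m + 1)) := by
    rw [MvPowerSeries.subst_sub hS]; ring
  have h2 : MvPowerSeries.coeff d (MvPowerSeries.subst ψ (G - g (m + 1))) = 0 := by
    apply MvPowerSeries.coeff_of_lt_order
    calc (d.degree : ℕ∞) < ((m + 1 + 1 : ℕ) : ℕ∞) := by rw [← hm]; exact_mod_cast (by omega)
      _ ≤ (G - g (m + 1)).order := hGm (m + 1)
      _ ≤ _ := (order_subst_eq_of_monPlus hψ _).ge
  have h3 : MvPowerSeries.coeff d (MvPowerSeries.subst ψ (g (m + 1))) =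
      MvPowerSeries.coeff d f := by
    have e1 : MvPowerSeries.subst ψ (g (m + 1)) - f =
        MvPowerSeries.subst ψ (g (m + 1) - g m) - (g (m + 1) - g m) := by
      rw [g_succ m]
      simp only [MvPowerSeries.subst_sub hS]
      ring
    have h0 : MvPowerSeries.coeff d (MvPowerSeries.subst ψ (g (m + 1)) - f) = 0 := by
      rw [e1]
      apply MvPowerSeries.coeff_of_lt_order
      calc (d.degree : ℕ∞) < ((m + 1 + 1 : ℕ) : ℕ∞) := by rw [← hm]; exact_mod_cast (by omega)
        _ ≤ _ := succ_le_order_subst_sub_self hψ (incr m)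
    rwa [map_sub, sub_eq_zero] at h0
  rw [h1, map_add, h2, add_zero, h3]

/-- **The formal inverse function theorem: a tangent-to-identity substitution of `k[[x_σ]]`
(`σ` finite) is bijective** — the «if» direction of the cited theorem in the normalised case. [cite: GreuelPfister2002, Thm. 6.2.18 (Inverse Function Theorem)] -/
theorem subst_bijective_of_monPlus (hψ : ∀ i, MonPlus (ψ i) (Finsupp.single i 1)) :
    Function.Bijective (MvPowerSeries.subst ψ : MvPowerSeries σ k → MvPowerSeries σ k) :=
  ⟨subst_injective_of_monPlus hψ, subst_surjective_of_monPlus hψ⟩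

/-- The same for the `k`-algebra map `substAlgHom` («`φ` … is an isomorphism»). [cite: GreuelPfister2002, Thm. 6.2.18 (Inverse Function Theorem)] -/
theorem substAlgHom_bijective_of_monPlus (hψ : ∀ i, MonPlus (ψ i) (Finsupp.single i 1)) :
    Function.Bijective
      (MvPowerSeries.substAlgHom (R := k) (hasSubst_of_monPlus hψ) :
        MvPowerSeries σ k →ₐ[k] MvPowerSeries σ k) := by
  rw [MvPowerSeries.coe_substAlgHom]
  exact subst_bijective_of_monPlus hψ

/-- The `k`-algebra AUTOMORPHISM of `k[[x_σ]]` given by a tangent-to-identity substitution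
(`AlgEquiv.ofBijective`; stated as an existence so that this file stays definition-free).
[cite: GreuelPfister2002, Thm. 6.2.18 (Inverse Function Theorem)] -/
theorem exists_algEquiv_eq_subst (hψ : ∀ i, MonPlus (ψ i) (Finsupp.single i 1)) :
    ∃ e : MvPowerSeries σ k ≃ₐ[k] MvPowerSeries σ k,
      (∀ F, e F = MvPowerSeries.subst ψ F) ∧ ∀ i, e (MvPowerSeries.X i) = ψ i := by
  refine ⟨AlgEquiv.ofBijective _ (substAlgHom_bijective_of_monPlus hψ), fun F => ?_, fun i => ?_⟩
  · rw [AlgEquiv.ofBijective_apply, MvPowerSeries.substAlgHom_apply]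
  · rw [AlgEquiv.ofBijective_apply, MvPowerSeries.substAlgHom_apply,
      MvPowerSeries.subst_X (hasSubst_of_monPlus hψ) i]

/-- **The inverse is again a tangent-to-identity substitution**: there is `φ` with
`φ i = X_i + h.o.t.`, `subst φ ∘ subst ψ = id` and `subst ψ ∘ subst φ = id` («let `ψ` be its inverse and
`g_i := ψ(x_i)`»). [cite: GreuelPfister2002, Thm. 6.2.18 (Inverse Function Theorem)] -/
theorem exists_inverse_subst_of_monPlus (hψ : ∀ i, MonPlus (ψ i) (Finsupp.single i 1)) :
    ∃ φ : σ → MvPowerSeries σ k, (∀ i, MonPlus (φ i) (Finsupp.single i 1)) ∧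
      (∀ F, MvPowerSeries.subst φ (MvPowerSeries.subst ψ F) = F) ∧
      (∀ F, MvPowerSeries.subst ψ (MvPowerSeries.subst φ F) = F) := by
  classical
  choose φ hφ using fun i => subst_surjective_of_monPlus hψ (MvPowerSeries.X i)
  have hφ1 : ∀ i, MonPlus (φ i) (Finsupp.single i 1) := by
    intro i
    have hord : (φ i).order = 1 := by
      rw [← order_subst_eq_of_monPlus hψ, hφ, MvPowerSeries.X_def,
        MvPowerSeries.order_monomial_of_ne_zero one_ne_zero, Finsupp.degree_single, Nat.cast_one]
    have hc : ∀ e : σ →₀ ℕ, e.degree ≤ 1 →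
        MvPowerSeries.coeff e (φ i) = MvPowerSeries.coeff e (MvPowerSeries.X i) := fun e he => by
      rw [← hφ i, coeff_subst_of_degree_le_order hψ (φ i) e (by rw [hord]; exact_mod_cast he)]
    apply monPlus_single_of_coeff
    · rw [← MvPowerSeries.coeff_zero_eq_constantCoeff_apply, hc 0 (by simp),
        MvPowerSeries.coeff_zero_eq_constantCoeff_apply, MvPowerSeries.constantCoeff_X]
    · intro j
      rw [hc _ (by simp [Finsupp.degree_single]), MvPowerSeries.coeff_X]
      by_cases hij : i = j
      · subst hij; simp
      · rw [if_neg, if_neg hij]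
        exact fun h => hij ((Finsupp.single_left_inj one_ne_zero).mp h).symm
  have hright : ∀ F, MvPowerSeries.subst ψ (MvPowerSeries.subst φ F) = F := fun F => by
    rw [MvPowerSeries.subst_comp_subst_apply (hasSubst_of_monPlus hφ1) (hasSubst_of_monPlus hψ)]
    have : (fun s => MvPowerSeries.subst ψ (φ s)) = (MvPowerSeries.X : σ → MvPowerSeries σ k) :=
      funext hφ
    rw [this, MvPowerSeries.subst_self, id]
  exact ⟨φ, hφ1, fun F => subst_injective_of_monPlus hψ (by rw [hright]), hright⟩

/-- **Re-centring one formal coordinate.** For `2 ≤ order V` there is a `k`-algebra automorphism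
`e` of `k[[x_σ]]` with `e (X i) = X i + V`, `e (X j) = X j` for `j ≠ i`, given by the substitution
`Function.update X i (X i + V)`; its inverse `e.symm` re-centres `X i + V ↦ X i`.  (Shape of the
re-coordinatisation `y ↦ y − u`, `ω` fixed, of a formal frame `k[[y, ω]]` when `u ↦ −V` has order
`≥ 2`; the coordinate change «`φ(x_i) = x_i + b_i`» of Boubakri–Greuel–Markwig, Lemma 2.2, for one `i`.)
[cite: GreuelPfister2002, Thm. 6.2.18 (Inverse Function Theorem)] -/
theorem exists_algEquiv_X_add (i : σ) {V : MvPowerSeries σ k} (hV : 2 ≤ V.order) :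
    ∃ e : MvPowerSeries σ k ≃ₐ[k] MvPowerSeries σ k,
      (∀ F, e F = MvPowerSeries.subst (Function.update MvPowerSeries.X i (MvPowerSeries.X i + V)) F) ∧
      e (MvPowerSeries.X i) = MvPowerSeries.X i + V ∧
      (∀ j, j ≠ i → e (MvPowerSeries.X j) = MvPowerSeries.X j) ∧
      e.symm (MvPowerSeries.X i + V) = MvPowerSeries.X i := by
  obtain ⟨e, he, heX⟩ := exists_algEquiv_eq_subst (monPlus_update_X_add i hV)
  have hi : e (MvPowerSeries.X i) = MvPowerSeries.X i + V := by
    rw [heX, Function.update_self]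
  refine ⟨e, he, hi, fun j hj => ?_, ?_⟩
  · rw [heX, Function.update_of_ne hj]
  · rw [← hi, AlgEquiv.symm_apply_apply]

end TangentToIdentity

/-! ### `σ = Fin n`: comparison with `TangentId` -/

/-- For `σ = Fin n` the standing hypothesis of this file is the predicate `TangentId` of
`FormalCoordinateChange.lean` (the normalisation `(∂f_i/∂x_j(0)) = (δ_ij)`). [cite: GreuelPfister2002, Thm. 6.2.18 (proof: normalisation (∂f_i/∂x_j(0)) = (δ_ij))] -/
theorem tangentId_iff_monPlus {n : ℕ} {ψ : Fin n → MvPowerSeries (Fin n) k} :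
    TangentId ψ ↔ ∀ i, MonPlus (ψ i) (Finsupp.single i 1) :=
  ⟨fun h i => h.monPlus i, fun h =>
    ⟨fun i => constantCoeff_eq_zero_of_monPlus_single (h i),
      fun i j => coeff_single_of_monPlus_single (h i) j⟩⟩

/-- Order preservation for a `TangentId` family (`σ = Fin n`).
[cite: BoubakriGreuelMarkwig2010, Lemma 2.2 (proof: φ(x_i) = x_i + b_i)] -/
theorem TangentId.order_subst_eq {n : ℕ} {ψ : Fin n → MvPowerSeries (Fin n) k} (h : TangentId ψ)
    (F : MvPowerSeries (Fin n) k) : (MvPowerSeries.subst ψ F).order = F.order :=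
  order_subst_eq_of_monPlus (tangentId_iff_monPlus.mp h) F

/-- Bijectivity for a `TangentId` family (`σ = Fin n`; cf. `exists_comp_inverse` of
`FormalInverseFunction.lean` for the compositional-inverse form).
[cite: GreuelPfister2002, Thm. 6.2.18 (Inverse Function Theorem)] -/
theorem TangentId.subst_bijective {n : ℕ} {ψ : Fin n → MvPowerSeries (Fin n) k} (h : TangentId ψ) :
    Function.Bijective (MvPowerSeries.subst ψ : MvPowerSeries (Fin n) k → MvPowerSeries (Fin n) k) :=
  subst_bijective_of_monPlus (tangentId_iff_monPlus.mp h)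

end Literature.AlgebraicGeometry.Resolution.FormalCoordChange
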